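import Summits.HodgeConjecture.HodgeConjecture.Theorems.Ring2TransportWeilClasses
import Summits.HodgeConjecture.HodgeConjecture.Theorems.PadicSemiregularLiftHodgeAbelianVarietiesCMPivotBridgeItems
import Summits.HodgeConjecture.HodgeConjecture.Theorems.WeilTypeLadderOnPath
import Summits.HodgeConjecture.HodgeConjecture.Theses.RankFourFaces
import Summits.HodgeConjecture.HodgeConjecture.Theses.PadicSemiregularLift
import Summits.HodgeConjecture.HodgeConjecture.Theses.SevenfoldWeilCensus
import Literature.AlgebraicGeometry.HodgeTheory.BlochSemiregularityTheorem
import Literature.AlgebraicGeometry.HodgeTheory.SemiregularVariationalHodge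
import Literature.AlgebraicGeometry.HodgeTheory.AbelianLowDimensionWeilReduction
import HarnessLib

/-!
# Ring 2 — the HYPOTHESES layer, II: the CM-local inputs (CM pivot) and the low-dimension reduction

HONEST FRAMING (page 1, verbatim the cell's standing line): **research route conditional on HC_CM; not a
corollary; Q11.4-sentence-2 already refuted in dim ≥ 3.** Nothing in this file proves a case of the Hodge
conjecture. `HC_CM` is an OPEN statement and enters every conditional theorem below as an explicit HYPOTHESIS
(a binder), written BY NAME as the route item `Theses.RankFourFaces.CMAbelianHodge` (stmt-HodgeConjecture-3052;
no copy, no abbreviation); never cited, never treated as known. Companion of `Ring2Hypotheses.lean` (the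
blanket-variational inputs, where `HC_CM` is dominated) and `Ring2HypothesesDescent.lean` (absolute Hodge /
motivated, where `HC_CM` plays no role). THIS file holds the rows on which `HC_CM` is genuinely consumed:

* §A the CM-PIVOT typing of `HC_CM ⟹ HC_AV` (children 2 and 3 of crux `HodgeAbelianVarieties`, line
  `cm-pivot`, tree file `Theorems/PadicSemiregularLiftHodgeAbelianVarietiesCMPivotBridgeItems.lean`, which proves
  `CMAbelianHodge → CMAnchoredFamilies[] → LocalVHCAtCM[] → HodgeAbelianVarieties` sorry-free with the two
  hypotheses spelled as FILE-LOCAL NOTATIONS): the named `def`s `CMAnchoredFamilies` (the brief's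
  `MT_generated_by_CM ⟨all abelian varieties⟩`, geometric form: Deligne 1982 Prop. 6.1 — THEOREM IN PRINT,
  unformalised) and `LocalVHCAtCM` (the brief's `VHC_instance ⟨germ at a CM fibre⟩` — OPEN; the output shape of
  the STRICT semiregularity theorems) copy those notations verbatim, so the tree's composition re-exports
  definitionally as `hc_av_of_hc_cm_of_cmAnchoredFamilies_of_localVHCAtCM`. Here `HC_CM` is load-bearing and NOT
  dominated by the other inputs in the tree (contrast `Ring2.Deform.HC_CM_of_abelianSchemeVHC`).
* §B the printed STRICT semiregularity theorems, by name (Literature facts; the S-route inputs with data are in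
  `Theorems/Ring2TransportSemiregular.lean`).
* §C the Moonen–Zarhin reading `HC_CM ∧ CMPointedWeilFamiliesQuadratic ∧ (R∞var | LocalWeilVHCAtCMQuadratic) ∧
  [Moonen–Zarhin 1999] ⟹ HC(dim ≤ 5)` (item `Theses.SevenfoldWeilCensus.HodgeAbelianDimLeFive`,
  stmt-HodgeConjecture-18723) from the landed `Ring2Transport.HC_WeilClassesQuadratic_of_HC_CM[_local]`, with its
  honest column (ref1 F2, C10: a READING of a printed reduction, not progress) and on-path lemmas.

| name | renders | status in print | feeds |
|------|---------|-----------------|-------|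
| `CMAnchoredFamilies` | Deligne 1982 Prop. 6.1 / Charles–Schnell Thm. 11.5.11 + Mumford 1969 §3, geometric form (= CM-pivot child 2) | THEOREM IN PRINT, unformalised | `HC_AV` (with `LocalVHCAtCM`) |
| `LocalVHCAtCM` | Conj. 11.3.1 as a germ at a CM fibre of a family of abelian varieties (= CM-pivot child 3) | OPEN | `HC_AV` |
| `HodgeTheory.Bloch1972_semiregularSubschemeLifts`, `HodgeTheory.BuchweitzFlenner2003_variationalHodge_semiregular` | Bloch Thm. 7.1/7.4; Buchweitz–Flenner Thm. 5.1 (used by name) | THEOREMS (strict semiregularity) | S route |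
| `HodgeTheory.MoonenZarhin1999_hodgeClasses_abelian_dim_le_five_of_weilClassesFourfolds` | Weil classes on 4-folds ⟹ HC in dim ≤ 5 (used by name) | THEOREM | HC(dim ≤ 5) |

References (bib keys): Deligne1982HodgeCycles (Intro p. 6, Prop. 6.1), CharlesSchnell2014Notes (Conj. 11.3.1,
Prop. 11.3.11, Thm. 11.5.11), Mumford1969NoteShimura (§3), Bloch1972Semiregularity (Thm. 7.1,
7.4), BuchweitzFlenner2003 (Thm. 5.1), BlochEsnaultKerz2014CharZero (appendix), MoonenZarhin1999 (dim ≤ 5),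
Schoen1988HodgeWeil, vanGeemen1994HodgeAV (Thm. 4.3, §5, Thm. 6.12), Weil1977HodgeRing,
Markman2025SecantWeil (Cor. 1.6.1, unrefereed), KerrPearlstein2016 (Abdulali's survey), Abdulali2005CMHodge,
Hazama2002GHCCM.
-/

set_option linter.dupNamespace false

noncomputable section

open CategoryTheory
open Literature.AlgebraicGeometry Literature.AlgebraicGeometry.Motives
open Literature.AlgebraicGeometry.HodgeTheory

namespace Summit.HodgeConjecture.HodgeConjecture.Ring2.Hypotheses

/-! ## §A The CM-pivot typing (children 2 and 3 of crux `HodgeAbelianVarieties`, line `cm-pivot`)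

The tree proves `CMAbelianHodge → CMAnchoredFamilies[] → LocalVHCAtCM[] → HodgeAbelianVarieties`
(`Theorems/PadicSemiregularLiftHodgeAbelianVarietiesCMPivotBridgeItems.lean`, sorry-free) with the two
hypotheses spelled as FILE-LOCAL NOTATIONS. The four auxiliary notations and the two children are copied
verbatim below so that the named `def`s unfold to the tree's terms definitionally. -/

/-- `IsCM[A]` — CM type in the eigenvalue typing: an endomorphism with `2 · dim A` distinct eigenvalues on
`H¹(A(ℂ); ℂ)` (verbatim the CM-pivot notation; equivalent to the `CMAbelianHodge` typing by the tree's
`isCM_iff_exists_cmSubalgebra`). Local notation only. -/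
local notation3 (prettyPrint := false) "IsCM[" A "]" =>
  ∃ (ψ : A ⟶ A) (μ : Fin (2 * AbelianVariety.dim A) → ℂ), Function.Injective μ ∧
    ∀ i, Module.End.HasEigenvalue (HodgeTheory.complexBetti.map ψ.hom.hom.hom 1).hom (μ i)

/-- `QProj[X]` — `X` quasi-projective over `ℂ` (inlined body of `HodgeTheory.IsQuasiProjectiveOver X`).
Local notation only. -/
local notation3 (prettyPrint := false) "QProj[" X "]" =>
  ∃ (P : SchemeOver ℂ) (j : X ⟶ P), IsProjectiveOver P ∧ AlgebraicGeometry.IsOpenImmersion j.left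

/-- `FibreIncl[f, B, e, s]` — `e` presents `B` as the fibre of `f` over `s`. Local notation only. -/
local notation3 (prettyPrint := false) "FibreIncl[" f ", " B ", " e ", " s "]" =>
  ∃ i : AbelianVariety.X B ≅ fiberOver f s, e = CategoryStruct.comp i.hom (fiberι f s)

/-- `HodgeAlong[S, 𝒳, f, G, p]` — `G` is rational `(p,p)` on every fibre presented as an abelian variety.
Local notation only. -/
local notation3 (prettyPrint := false) "HodgeAlong[" S ", " 𝒳 ", " f ", " G ", " p "]" =>
  ∀ (B : AbelianVariety ℂ) (eB : AbelianVariety.X B ⟶ 𝒳) (u : ComplexPoints S),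
    FibreIncl[f, B, eB, u] →
      HodgeTheory.IsRationalClass (HodgeTheory.complexBetti.map eB (2 * p) G) ∧
      HodgeTheory.IsOfHodgeType B.dim B.X (2 * p) p p (HodgeTheory.complexBetti.map eB (2 * p) G)

/-- **`CMAnchoredFamilies` — CM-anchored Mumford–Tate packaging of every Hodge class on every complex
abelian variety** (verbatim child 2 `CMAnchoredFamilies[]` of the CM pivot; the cell brief's
`MT_generated_by_CM ⟨all abelian varieties⟩` in its geometric form): every rational `(p,p)` class `c` on `A`
is the restriction `e^* G` of a class `G` on the total space of a smooth projective family `f : 𝒳 ⟶ S` of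
relative dimension `dim A` over a smooth irreducible quasi-projective base with quasi-projective total
space, `G` rational `(p,p)` on every fibre presented as an abelian variety, the family containing `A` as the
fibre at `t` and a CM abelian variety `A₀` (eigenvalue typing `IsCM[A₀]`) as the fibre at `s₀`.
THEOREM IN PRINT, unformalised: Deligne 1982, Prop. 6.1 (with Intro p. 6: "one shows that it suffices to
prove the main result for `A` an abelian variety of CM-type") = Charles–Schnell Thm. 11.5.11 (Mumford–Tate
families at neat level, the theorem of the fixed part, density of special = CM points after Mumford 1969).
NOT a case of HC (it asserts CM fibres), hence no on-path lemma. A hypothesis in Lean (the tree reduces it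
further to `NonCMSections[]` / `HodgeLocusCMSection[]`, file `…CMPivotStubCmAnchoredFamilies`).
[cite: Deligne1982HodgeCycles, Prop. 6.1] [cite: CharlesSchnell2014Notes, Thm. 11.5.11] [cite: Mumford1969NoteShimura, §3] -/
@[conjecture] def CMAnchoredFamilies : Prop :=
  ∀ (A : AbelianVariety ℂ) (p : ℕ) (c : HodgeTheory.complexBetti A.X (2 * p)),
    HodgeTheory.IsRationalClass c → HodgeTheory.IsOfHodgeType A.dim A.X (2 * p) p p c →
    ∃ (S 𝒳 : SchemeOver ℂ) (f : 𝒳 ⟶ S) (G : HodgeTheory.complexBetti 𝒳 (2 * p))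
      (t s₀ : ComplexPoints S) (e : A.X ⟶ 𝒳) (A₀ : AbelianVariety ℂ) (e₀ : A₀.X ⟶ 𝒳),
      QProj[𝒳] ∧ QProj[S] ∧ AlgebraicGeometry.Smooth S.hom ∧ IrreducibleSpace S.left ∧
      IsSmoothProjectiveFamily f A.dim ∧
      FibreIncl[f, A, e, t] ∧ FibreIncl[f, A₀, e₀, s₀] ∧ IsCM[A₀] ∧
      HodgeTheory.complexBetti.map e (2 * p) G = c ∧ HodgeAlong[S, 𝒳, f, G, p]

/-- **`LocalVHCAtCM` — the variational Hodge conjecture AS A GERM AT A CM FIBRE of a family of abelian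
varieties** (verbatim child 3 `LocalVHCAtCM[]` of the CM pivot; the cell brief's `VHC_instance ⟨germ at a CM
fibre⟩`): for `f : 𝒳 ⟶ S` smooth projective of relative dimension `m` over a smooth irreducible
quasi-projective base, quasi-projective total space, a CM abelian fibre `A₀ = 𝒳_{s₀}` and a global class `G`
rational `(p,p)` on every abelian fibre whose value on `A₀` is ALGEBRAIC, `G|_{𝒳_t}` is algebraic for all
`t` in a Euclidean neighbourhood of `s₀`. OPEN (the tree localises it to the deep middle `m ≥ 4`,
`2 ≤ p ≤ m - 2`, file `…CMPivotStubLocalVHCAtCM`). This is where `HC_CM` is consumed: it makes the CM fibre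
an algebraic anchor, and `LocalVHCAtCM` transports. Output shape of the STRICT semiregularity theorems
(Bloch 1972 Thm. 7.4; Buchweitz–Flenner Thm. 5.1), not the refuted weak criterion. (The germ-to-global
step that consumes this germ uses that the locus of classes of algebraic cycles is a countable union of closed
algebraic subsets — Hilbert schemes, proof of Charles–Schnell Prop. 11.3.11; this docstring-only revision
corrects the earlier locator "Thm. 11.3.17", which is the `ℚ̄`-criterion for absoluteness and is not used here.)
[cite: CharlesSchnell2014Notes, Conj. 11.3.1 and Prop. 11.3.11 (proof)] [cite: BlochEsnaultKerz2014CharZero, appendix] -/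
@[conjecture] def LocalVHCAtCM : Prop :=
  ∀ (S 𝒳 : SchemeOver ℂ) (f : 𝒳 ⟶ S) (m p : ℕ) (G : HodgeTheory.complexBetti 𝒳 (2 * p))
    (s₀ : ComplexPoints S) (A₀ : AbelianVariety ℂ) (e₀ : A₀.X ⟶ 𝒳),
    QProj[𝒳] → QProj[S] → AlgebraicGeometry.Smooth S.hom → IrreducibleSpace S.left →
    IsSmoothProjectiveFamily f m →
    FibreIncl[f, A₀, e₀, s₀] → IsCM[A₀] →
    HodgeTheory.complexBetti.map e₀ (2 * p) G ∈ HodgeTheory.algebraicClasses A₀.X p →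
    HodgeAlong[S, 𝒳, f, G, p] →
    ∃ U : Set (ComplexPoints S), IsOpen U ∧ s₀ ∈ U ∧ ∀ t ∈ U,
      HodgeTheory.complexBetti.map (fiberι f t) (2 * p) G ∈
        HodgeTheory.algebraicClasses (fiberOver f t) p

/-- **`HC_AV_of_HC_CM`, CM-pivot form** — `HC_CM ∧ CMAnchoredFamilies ∧ LocalVHCAtCM ⟹ HC_AV`: the tree's
sorry-free composition `hodgeAbelianVarieties_of_cmAbelianHodge_of_cmAnchoredFamilies_of_localVHCAtCM`
(local-to-global along the base: the algebraicity locus is a countable union of closed algebraic subsets —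
Hilbert schemes, proof of Charles–Schnell Prop. 11.3.11; irreducible base), re-exported with NAMED
hypotheses. `HC_CM` is load-bearing (anchor at the CM fibre) and — unlike the blanket-VHC rows — NOT
dominated by the other inputs in the tree.
[cite: Deligne1982HodgeCycles, Prop. 6.1] [cite: CharlesSchnell2014Notes, Prop. 11.3.11 (proof)] -/
theorem hc_av_of_hc_cm_of_cmAnchoredFamilies_of_localVHCAtCM
    (hCM : Theses.RankFourFaces.CMAbelianHodge) (hMT : CMAnchoredFamilies) (hV : LocalVHCAtCM) :
    Theses.PadicSemiregularLift.HodgeAbelianVarieties :=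
  Theorems.HodgeAbelianVarieties.CMPivot.hodgeAbelianVarieties_of_cmAbelianHodge_of_cmAnchoredFamilies_of_localVHCAtCM
    hCM hMT hV

/-- The transport half alone: `CMAnchoredFamilies ∧ LocalVHCAtCM ⟹ CMToAbelian` (item 16267), the tree's
`cmToAbelian_of_cmAnchoredFamilies_of_localVHCAtCM`. [cite: Deligne1982HodgeCycles, Prop. 6.1] -/
theorem cmToAbelian_of_cmAnchoredFamilies_of_localVHCAtCM (hMT : CMAnchoredFamilies) (hV : LocalVHCAtCM) :
    Theses.RankFourFaces.CMToAbelian :=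
  Theorems.HodgeAbelianVarieties.CMPivot.cmToAbelian_of_cmAnchoredFamilies_of_localVHCAtCM hMT hV

/-! ## §B Semiregularity (route S): the printed theorems, by name

The STRICT semiregularity theorems are Literature facts of the tree and are used BY NAME (no summit-side
copy): `HodgeTheory.Bloch1972_semiregularSubschemeLifts` (the brief's `Semiregular ⟨lci subschemes⟩`: Bloch
1972 Thm. (7.1) with the proof of Thm. (7.4) — a Bloch-semiregular lci `Z₀ ⊂ X₀` of codimension `p` whose
class stays of type `(p,p)` along `f` lifts to a flat family of subschemes over an étale neighbourhood) and
`HodgeTheory.BuchweitzFlenner2003_variationalHodge_semiregular` (the brief's `Semiregular ⟨coherent sheaves /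
perfect complexes⟩`: Buchweitz–Flenner 2003 Thm. 5.1 — if the semiregularity map
`σ : Ext²(F, F) → ∏ H^{p+2}(X, Ω^{p}_X)` is injective and `ch(F)` stays Hodge along the deformation, `F`
deforms, hence `ch_p` stays algebraic near `0`); they are THEOREMS in print and hypotheses in Lean. What the
S route needs beyond them — that the algebraic class at a CM fibre HAS a (Bloch- or Buchweitz–Flenner-) semiregular representative and that its
lift makes the class algebraic along the family (`SemiregularLiftAtCMPoints C`,
`SemiregularlyAnchoredWeilFamiliesCMField C`, `SemiregularTransport`) — carries DATA (`SemiregularAnchor`) and is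
filed in the companion `Theorems/Ring2TransportSemiregular.lean`; it is OPEN (Markman 2025, Question 11.4
sentence 1, for secant sheaves; unrefereed). The WEAK criterion (Q11.4 sentence 2) is refuted for abelian
varieties of dimension ≥ 3 (`HodgeTheory/SemiregularityWeakCriterionAbelianCounterexampleFull.lean`); only
strict semiregularity hypotheses are admissible (referee ruling C5). The germ OUTPUT of the strict theorems,
asked only at CM-charted algebraic fibres, is the landed leaf `Ring2Transport.LocalWeilVHCAtCMQuadratic`. -/

/-! ## §C Mumford–Tate / Hodge-ring reductions: the printed reductions, by name

* Mumford–Tate CM anchoring for ALL abelian varieties: `CMAnchoredFamilies` (§A) / `MumfordTateCMAnchors`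
  (`Ring2Hypotheses.lean`;
  Deligne 1982 Prop. 6.1). For the Weil-type classes: the landed `Ring2Transport.CMPointedWeilFamiliesCMField`,
  `Ring2Transport.CMPointedWeilFamiliesQuadratic`.
* Hodge-ring reduction in low dimension (Moonen–Zarhin 1999): on abelian varieties of dimension ≤ 5 every
  Hodge class is algebraic as soon as the Weil classes on Weil-type abelian FOURFOLDS are — the tree fact
  `HodgeTheory.MoonenZarhin1999_hodgeClasses_abelian_dim_le_five_of_weilClassesFourfolds` (the brief's
  `HodgeRingReduction ⟨dim ≤ 5⟩`; with Tankeev and Ribet, combination step proved in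
  `AbelianLowDimensionWeilReductionProofs`), used BY NAME, and the chain
  `HC_CM ∧ CMPointedWeilFamiliesQuadratic ∧ (R∞var | LocalWeilVHCAtCMQuadratic)
  ∧ [Moonen–Zarhin] ⟹ HC(dim ≤ 5)` (item stmt-HodgeConjecture-18723) proved from the landed
  `Ring2Transport.HC_WeilClassesQuadratic_of_HC_CM[_local]`. HONEST COLUMN (ref1 F2, C10): the fourfold case of
  R∞ that Moonen–Zarhin need is KNOWN IN PRINT modulo refereeing (Schoen 1988 / van Geemen 1994 §5 for
  `ℚ(√-3)`, `ℚ(i)`; Markman 2025 Cor. 1.6.1, unrefereed, for all `d` and discriminants — tree fact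
  `Markman2025_weilClasses_algebraic_abelianFourfold`), and for imaginary quadratic `K` the CM hypothesis is
  dominated in print by the diagonal CM member `E⁴` of the Weil family (Hodge ring generated by divisors);
  so this row is the `HC_CM`-routed READING of a printed reduction, not progress on HC(dim ≤ 5).
* The general Hodge-ring statement "`Hg(X) = SU(W,H)` ⟹ `B^•(X)` is generated by divisor classes and the
  Weil classes `W_K`" (Weil 1977; van Geemen 1994 Thm. 6.12) is NOT typed: the tree has no unitary group of a
  `K`-Hermitian form on `H¹(X;ℚ)` to state the genericity hypothesis; recorded as WANTED in the cell map.
* Abdulali / Hazama (usual HC for CM abelian varieties ⟹ GENERAL HC for CM abelian varieties; Abdulali's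
  "dominated by CM" classes): a consequence row of `HC_CM` INSIDE the CM class (cell CONSEQUENCES.md); not a
  transport input and not typed here. -/

/-- **`HC(dim ≤ 5)` from `HC_CM`, ring-2 reading, GLOBAL Weil-confined variational input**:
`HC_CM ∧ CMPointedWeilFamiliesQuadratic ∧ WeilVariationalHodgeQuadratic ∧ [Moonen–Zarhin 1999] ⟹
Theses.SevenfoldWeilCensus.HodgeAbelianDimLeFive` (item stmt-HodgeConjecture-18723), by the landed
`Ring2Transport.HC_WeilClassesQuadratic_of_HC_CM` and the tree's
`WeilTypeLadder.floorDimLeFive_of_weilClassesImaginaryQuadratic_of_moonenZarhin`. `HC_CM` enters only through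
the anchors of the quadratic Weil fourfold families (dominated in print, see the section note).
[cite: MoonenZarhin1999, Thm. (dim ≤ 5)] [cite: Deligne1982HodgeCycles, §6 Prop. 6.1]
[cite: Schoen1988HodgeWeil, Thm.] [cite: vanGeemen1994HodgeAV, §5 and Thm. 6.12] -/
theorem hc_dimLeFive_of_hc_cm_of_cmPointedQuadratic_of_weilVariational (hCM : Theses.RankFourFaces.CMAbelianHodge)
    (hF : Ring2Transport.CMPointedWeilFamiliesQuadratic) (hV : WeilTypeLadder.WeilVariationalHodgeQuadratic)
    (hMZ : MoonenZarhin1999_hodgeClasses_abelian_dim_le_five_of_weilClassesFourfolds) :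
    Theses.SevenfoldWeilCensus.HodgeAbelianDimLeFive :=
  WeilTypeLadder.floorDimLeFive_of_weilClassesImaginaryQuadratic_of_moonenZarhin hMZ
    (Ring2Transport.HC_WeilClassesQuadratic_of_HC_CM hCM hF hV)

/-- **`HC(dim ≤ 5)` from `HC_CM`, ring-2 reading, LOCAL germ input at CM fibres** (the weakest typed survivor
of the transport audit, `Ring2Transport.LocalWeilVHCAtCMQuadratic`: the output shape of the STRICT
semiregularity theorems asked only at CM-charted algebraic fibres): `HC_CM ∧ CMPointedWeilFamiliesQuadratic ∧
LocalWeilVHCAtCMQuadratic ∧ [Moonen–Zarhin 1999] ⟹ HodgeAbelianDimLeFive`, by the landed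
`Ring2Transport.HC_WeilClassesQuadratic_of_HC_CM_local`. [cite: MoonenZarhin1999, Thm. (dim ≤ 5)]
[cite: BuchweitzFlenner2003, Thm. 5.1] [cite: CharlesSchnell2014Notes, Prop. 11.3.11] -/
theorem hc_dimLeFive_of_hc_cm_of_cmPointedQuadratic_of_localWeilVHCAtCM (hCM : Theses.RankFourFaces.CMAbelianHodge)
    (hF : Ring2Transport.CMPointedWeilFamiliesQuadratic) (hL : Ring2Transport.LocalWeilVHCAtCMQuadratic)
    (hMZ : MoonenZarhin1999_hodgeClasses_abelian_dim_le_five_of_weilClassesFourfolds) :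
    Theses.SevenfoldWeilCensus.HodgeAbelianDimLeFive :=
  WeilTypeLadder.floorDimLeFive_of_weilClassesImaginaryQuadratic_of_moonenZarhin hMZ
    (Ring2Transport.HC_WeilClassesQuadratic_of_HC_CM_local hCM hF hL)

/-- ON-PATH: `HC_AV` gives HC(dim ≤ 5) (forget the dimension bound); the on-path lemma from the summit
itself is the LANDED `WeilTypeLadder.floorDimLeFive_of_hodgeConjecture` (used by name, not restated). [folklore] -/
theorem hc_dimLeFive_of_hc_av (h : Theses.PadicSemiregularLift.HodgeAbelianVarieties) :
    Theses.SevenfoldWeilCensus.HodgeAbelianDimLeFive :=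
  fun A _ _ p c hc hH => (h A).2 p c hc hH

/-! ## Audit: nothing is decided here

Every theorem above whose conclusion is `HC_AV` or HC(dim ≤ 5) has among its hypotheses an OPEN named
statement (`CMAnchoredFamilies` and `CMPointedWeilFamiliesQuadratic` are theorems in print but not in Lean;
`LocalVHCAtCM`, `WeilVariationalHodgeQuadratic`, `LocalWeilVHCAtCMQuadratic` are open) together with `HC_CM`
(load-bearing here), or it is an ON-PATH lemma from `HodgeConjecture` / `HC_AV`. Axiom closures: the three
standard axioms only. -/

#print axioms Summit.HodgeConjecture.HodgeConjecture.Ring2.Hypotheses.hc_av_of_hc_cm_of_cmAnchoredFamilies_of_localVHCAtCM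
#print axioms Summit.HodgeConjecture.HodgeConjecture.Ring2.Hypotheses.hc_dimLeFive_of_hc_cm_of_cmPointedQuadratic_of_weilVariational
#print axioms Summit.HodgeConjecture.HodgeConjecture.Ring2.Hypotheses.hc_dimLeFive_of_hc_cm_of_cmPointedQuadratic_of_localWeilVHCAtCM

end Summit.HodgeConjecture.HodgeConjecture.Ring2.Hypotheses

end
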